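import Summits.Langlands.Langlands.Theses.ParityBlindBianchi
import Summits.Langlands.Langlands.Theorems.ParityBlindBianchiResidualBianchiDoorLevelR
import HarnessLib

/-!
# Sketch (crux-ideate, ideator 2, round 1) for crux `ParityBlindBianchi.ResidualBianchiDoorLevelBC`
# (item stmt-Langlands-16853, E1″): idea `fibre-substitution`

First lemma of the line, stated over existing declarations and (since it is cheap) proved:
the landed K-side transfer `Sketch.stub_bcTransfer` (p98028) evaluates the three all-`n`
Arthur–Clozel named facts only at `(n, F, E) = (2, ℚ, K)`; replacing each evaluation by the
matching FIBRE — clause (a) / (c) / (d) of the hypothesis `QuadraticBaseChangeGL2` at `(ℚ, K)` —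
gives `stub_bcTransfer_fibre`, and the rest of p125055 (`stub_qLevel`, `stub_cuspWitness`,
`exists_padicModel_restrictField`) is reused verbatim: `ResidualBianchiDoorLevelBC_of_KW`.

Part 2 (optional rider, same idea): `Sketch.stub_qLevel_two` = the landed `stub_qLevel` (p101192) copied
verbatim at the `p = 2` FIBRE of the Serre fact (`hKW 2 k` is its only evaluation), and
`ResidualBianchiDoorLevelBC_of_serreModTwo` = the crux by name from `∀ k, khare_wintenberger 2 k` alone.
-/

noncomputable section

namespace Summit.Langlands.Langlands.Cruxes.ResidualBianchiDoorLevel.Sketch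

set_option linter.dupNamespace false

-- (H5) `mixedSpace ℚ` needs classical `Fintype` instances on the place subtypes (as in `AdelicGLnGlue`).
open scoped MatrixGroups Polynomial Valued Classical
open Polynomial NumberField IsDedekindDomain Filter CongruenceSubgroup
open Literature.NumberTheory.Automorphic Literature.NumberTheory.GaloisRepresentations
  Literature.NumberTheory.EllipticCurves.ModularForms

set_option linter.unusedVariables false in -- registered signature: `hirr` is implied by `hA5` and deliberately unused
/-- **`stub_qLevel_two` = the landed `stub_qLevel` (p101192) with its hypothesis cut down to the `p = 2` FIBRE of the Serre fact** (the only fibre the proof evaluates: `hKW 2 k`).  From Khare–Wintenberger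
(the tree's named fact, all `p`, `k`; only `p = 2` is used): for an irreducible icosahedral Artin
`ρ : Γ_ℚ → GL₂(ℂ)` and `ι : ℚ̄₂ ≃ ℂ` there are a finite set of PRIMES `S ∋ 2`, the entrywise model
`σ₀ = GL₂(ι⁻¹) ∘ ρ`, and a regular algebraic cuspidal `π` on `GL₂(𝔸_ℚ)` such that at EVERY place `v`
over no prime of `S`: `π` has a Satake parameter `α`, `σ₀` is unramified at `v`,
`charpoly σ₀(Frob_v) = (X - a)(X - b)` with `a, b ∈ ℤ̄₂`, congruent coefficientwise in `𝔪_{ℤ̄₂}` to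
`arithFrobPolyOfSatake ι q_v 2 α`.  Proof: `stub_residual` (+ `isOdd_of_charP_two`) feeds
`exists_newform_of_khare_wintenberger_two` (weight `2` or `4`, EVEN); residue-adapted embedding,
conjugate newform, adelic lift, arch parameter (landed SerreKW stubs 2–6); `stub_dictionaryC`;
`stub_predictedPolyCongr`; `S := {2} ∪ primes(N M) ∪` (the finitely many a.e.-exceptional and
`σ₀`-ramified primes). [cite: KhareWintenberger2009, Thm. 1.2 and Thm. 9.1] -/
theorem stub_qLevel_two
    (hKW2 : ∀ (k : Type) [Field k] [TopologicalSpace k] [DiscreteTopology k],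
      khare_wintenberger 2 k)
    (ι : PadicAlgCl 2 ≃+* ℂ) (ρ : FramedGaloisRep ℚ ℂ 2) (hirr : ρ.toGaloisRep.IsIrreducible)
    (hA5 : Nonempty ((Matrix.ProjGenLinGroup.mk.comp ρ.toMonoidHom).range ≃*
      alternatingGroup (Fin 5))) :
    ∃ S : Finset ℕ, 2 ∈ S ∧ (∀ ℓ ∈ S, ℓ.Prime) ∧ ∃ σ₀ : FramedGaloisRep ℚ (PadicAlgCl 2) 2,
      σ₀.toMonoidHom = (Matrix.GeneralLinearGroup.map ι.symm.toRingHom).comp ρ.toMonoidHom ∧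
      ∃ (hcpt : isCompact_glFiniteIntegralLevel 2 ℚ) (π : CuspidalAutomorphicRepData 2 ℚ hcpt),
        π.1.IsRegularAlgebraic ∧
        ∀ v : HeightOneSpectrum (𝓞 ℚ), (∀ ℓ ∈ S, ((ℓ : ℕ) : 𝓞 ℚ) ∉ v.asIdeal) →
          ∃ (α : Multiset ℂ) (a b : PadicAlgCl 2), ‖a‖ ≤ 1 ∧ ‖b‖ ≤ 1 ∧
            π.1.HasSatakeParamAt v α ∧ σ₀.IsUnramifiedAt v ∧
            σ₀.HasFrobCharpolyAt v ((X - C a) * (X - C b)) ∧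
            ∀ i : ℕ, ‖((X - C a) * (X - C b)).coeff i -
              (arithFrobPolyOfSatake ι v.residueCard 2 α).coeff i‖ < 1 := by
  classical
  haveI : Fact (Nat.Prime 2) := ⟨Nat.prime_two⟩
  -- (0) the entrywise model `σ₀ = GL₂(ι⁻¹) ∘ ρ`
  haveI : Finite ρ.toMonoidHom.range := finite_range_toMonoidHom ρ
  obtain ⟨σ₀, hσ₀, hfin, ⟨e₀⟩⟩ :=
    Summit.Langlands.Langlands.Theorems.ResidualBianchiDoorMod2.exists_map_ringEquiv ρ ι.symm
  obtain ⟨e⟩ := hA5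
  have hA5σ : Nonempty (projectiveImage σ₀.toMonoidHom ≃* alternatingGroup (Fin 5)) := ⟨e₀.trans e⟩
  -- (1) the residue field `k` (an algebraic closure of `ℤ̄₂/𝔪`, discrete) and the reduction `red`
  let O : Subring (PadicAlgCl 2) := 𝒪[PadicAlgCl 2]
  let k : Type := AlgebraicClosure (IsLocalRing.ResidueField O)
  letI : TopologicalSpace k := ⊥
  haveI : DiscreteTopology k := ⟨rfl⟩
  let red : O →+* k := (algebraMap (IsLocalRing.ResidueField O) k).comp (IsLocalRing.residue O)
  have hred : ∀ x : O, red x = 0 ↔ ‖(x : PadicAlgCl 2)‖ < 1 := by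
    intro x
    rw [RingHom.comp_apply, map_eq_zero_iff _ (algebraMap (IsLocalRing.ResidueField O) k).injective,
      IsLocalRing.residue_eq_zero_iff, IsLocalRing.mem_maximalIdeal, mem_nonunits_iff,
      Valuation.Integer.not_isUnit_iff_valuation_lt_one, PadicAlgCl.valuation_def,
      ← NNReal.coe_lt_coe, coe_nnnorm, NNReal.coe_one]
  have h2norm : ‖(2 : PadicAlgCl 2)‖ < 1 := by
    have h : ‖((2 : ℕ) : PadicAlgCl 2)‖ = 1 / 2 := by
      rw [← PadicAlgCl.valuation_coe, PadicAlgCl.valuation_p]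
      norm_num
    rw [Nat.cast_ofNat] at h
    rw [h]
    norm_num
  haveI : CharP k 2 := by
    have h2 : (2 : k) = 0 := by
      have h : red 2 = 0 := (hred 2).mpr (by
        have h' : ((2 : O) : PadicAlgCl 2) = 2 := by norm_cast
        rw [h']
        exact h2norm)
      rwa [map_ofNat] at h
    exact CharTwo.of_one_ne_zero_of_two_eq_zero one_ne_zero h2
  -- (2) the residual representation
  obtain ⟨σbar, hirrbar, hchar⟩ := stub_residual red hred σ₀ hfin hA5σ
  -- (3) Khare–Wintenberger at `p = 2`: a newform of weight `2` or `4`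
  obtain ⟨N, _instN, w, f, ιf, _h2N, hw24, hf, hKWf⟩ :=
    Summit.Langlands.Langlands.Theorems.ResidualBianchiDoorMod2.exists_newform_of_khare_wintenberger_two
      (hKW2 k) σbar hirrbar
  -- (4) residue-adapted embedding and the conjugate newform
  obtain ⟨τ, θ, hθ, hredθ⟩ :=
    Summit.Langlands.Langlands.Cruxes.SerreKWAutomorphicGL2.AdelicNewformDatumDoubleTwist.stub_residueAdaptedEmbedding
      2 k red ι N _ f hf ιf
  obtain ⟨M, _instM, g, hg, hconj⟩ :=
    Summit.Langlands.Langlands.Cruxes.SerreKWAutomorphicGL2.AdelicNewformDatumDoubleTwist.stub_conjugateNewform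
      N _ f hf τ
  -- (5) the automorphic side for `g`
  have hcpt₂ : isCompact_glFiniteIntegralLevel 2 ℚ := isCompact_glFiniteIntegralLevel_holds 2 ℚ
  have hw' : (2 : ℤ) ≤ ((w : ℕ) : ℤ) := by rcases hw24 with rfl | rfl <;> norm_num
  have hweven : Even ((w : ℕ) : ℤ) := by
    rcases hw24 with rfl | rfl
    · exact ⟨1, by norm_num⟩
    · exact ⟨2, by norm_num⟩
  obtain ⟨hsm, hlow⟩ :=
    Summit.Langlands.Langlands.Cruxes.SerreKWAutomorphicGL2.AdelicNewformDatumDoubleTwist.stub_loweringKillsLift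
      M _ g hcpt₂
  have hφ : adelicLiftFunA M (w : ℤ) ⇑g ∈ cuspFormsGL 2 ℚ hcpt₂ :=
    (Summit.Langlands.Langlands.Cruxes.SerreKWAutomorphicGL2.AdelicNewformDatumDoubleTwist.stub_adelicLiftIsCuspForm
      M _ hw' g hcpt₂ hsm hlow).mem_cuspFormsGL
  have hφ0 : adelicLiftFunA M (w : ℤ) ⇑g ≠ 0 :=
    Summit.Langlands.Langlands.Cruxes.SerreKWAutomorphicGL2.AdelicNewformDatumDoubleTwist.adelicLiftFunA_ne_zero_of_isNewform1 hg
  have harch :=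
    Summit.Langlands.Langlands.Cruxes.SerreKWAutomorphicGL2.AdelicNewformDatumDoubleTwist.stub_archParameterOfGeneratedDatum
      M _ g hcpt₂ hlow hφ hφ0
  obtain ⟨π₂, hRA, hsat₂⟩ :=
    stub_dictionaryC M _ hw' hweven g hg hcpt₂ (CuspidalAutomorphicRepData.ofCuspForm hφ hφ0)
      (CuspidalAutomorphicRepData.mem_W_ofCuspForm hφ hφ0)
      (CuspidalAutomorphicRepData.not_mem_W'_ofCuspForm hφ hφ0) harch
  -- (6) the finite exceptional sets and `S`
  have hunr : ∀ᶠ v : HeightOneSpectrum (𝓞 ℚ) in Filter.cofinite, σ₀.IsUnramifiedAt v := by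
    haveI := hfin
    exact σ₀.eventually_isUnramifiedAt_of_isOpen_ker (isOpen_ker_of_finite_range σ₀)
  obtain ⟨B, hBfin, hB⟩ : ∃ B : Set (HeightOneSpectrum (𝓞 ℚ)), B.Finite ∧ ∀ v ∉ B,
      σ₀.IsUnramifiedAt v ∧ π₂.1.HasSatakeParamAt v
        (((heckePolynomial g ((Rat.HeightOneSpectrum.primesEquiv v : Nat.Primes) : ℕ)).map
            (algebraMap (coeffCharField g) ℂ)).roots.map
          (fun β => (((Real.sqrt ((Rat.HeightOneSpectrum.primesEquiv v : Nat.Primes) : ℕ)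
            : ℝ) : ℂ)) ^ ((w : ℤ) - 1) * β⁻¹)) := by
    have h := hunr.and hsat₂
    rw [Filter.eventually_cofinite] at h
    exact ⟨_, h, fun v hv => not_not.mp hv⟩
  let S : Finset ℕ :=
    insert 2 ((N * M).primeFactors ∪ hBfin.toFinset.image Rat.HeightOneSpectrum.natGenerator)
  refine ⟨S, Finset.mem_insert_self _ _, ?_, σ₀, hσ₀, hcpt₂, π₂, hRA, ?_⟩
  · intro ℓ hℓ
    rcases Finset.mem_insert.mp hℓ with rfl | hℓ
    · exact Nat.prime_two
    rcases Finset.mem_union.mp hℓ with hℓ | hℓ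
    · exact Nat.prime_of_mem_primeFactors hℓ
    · obtain ⟨v, -, rfl⟩ := Finset.mem_image.mp hℓ
      exact Rat.HeightOneSpectrum.prime_natGenerator v
  -- (7) at a good place `v`
  intro v hv
  set q : ℕ := Rat.HeightOneSpectrum.natGenerator v with hqdef
  have hpq : ((Rat.HeightOneSpectrum.primesEquiv v : Nat.Primes) : ℕ) = q := rfl
  have hqS : q ∉ S := fun h => hv q h ((Rat.natCast_mem_asIdeal_iff v).2 dvd_rfl)
  have hqp : q.Prime := Rat.HeightOneSpectrum.prime_natGenerator v
  have hq2 : q ≠ 2 := fun h => hqS (h ▸ Finset.mem_insert_self _ _)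
  have hqodd : Odd q := hqp.odd_of_ne_two hq2
  have hvB : v ∉ B := fun h => hqS (Finset.mem_insert_of_mem (Finset.mem_union_right _
    (Finset.mem_image.mpr ⟨v, hBfin.mem_toFinset.mpr h, rfl⟩)))
  have hNM : N * M ≠ 0 := mul_ne_zero (NeZero.ne N) (NeZero.ne M)
  have hqNM : ¬ q ∣ N * M := fun h =>
    hqS (Finset.mem_insert_of_mem (Finset.mem_union_left _ (Nat.mem_primeFactors.mpr ⟨hqp, h, hNM⟩)))
  have hqN2 : ((Rat.HeightOneSpectrum.primesEquiv v : Nat.Primes) : ℕ) ∉ {q | q ∣ N * 2} := by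
    rw [hpq]
    intro h
    rcases (Nat.Prime.dvd_mul hqp).mp h with h | h
    · exact hqNM (h.mul_right M)
    · exact hq2 ((Nat.prime_dvd_prime_iff_eq hqp Nat.prime_two).mp h)
  obtain ⟨hunrv, hsatv⟩ := hB v hvB
  rw [hpq] at hsatv
  -- KW's local clause, a Frobenius at `v`, the residual char-poly bridge
  obtain ⟨-, Pint, hPint, hFrob⟩ := hKWf v hqN2
  rw [hpq] at hPint
  obtain ⟨𝔓, h𝔓⟩ := HeightOneSpectrum.primesAbove_nonempty v
  obtain ⟨φ, hφF⟩ := HeightOneSpectrum.exists_isArithFrobAt_of_mem_primesAbove_holds h𝔓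
  obtain ⟨P, a, b, ha, hb, hPab, hPσ, hPbar⟩ := hchar φ
  -- `σ₀` unramified at `v` ⇒ every Frobenius at `v` has char-poly `charpoly σ₀(φ) = (X-a)(X-b)`
  have hunrG : σ₀.toGaloisRep.IsUnramifiedAt v := (σ₀.isUnramifiedAt_toGaloisRep_iff v).mpr hunrv
  have hF : σ₀.HasFrobCharpolyAt v ((σ₀.toGaloisRep φ).charpoly) :=
    (FramedGaloisRep.hasFrobCharpolyAt_toGaloisRep_iff v _ σ₀).mp
      (hunrG.hasFrobCharpolyAt_charpoly h𝔓 hφF)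
  have hkey : (σ₀.toGaloisRep φ).charpoly = (X - C a) * (X - C b) := by
    rw [← hF 𝔓 h𝔓 φ hφF]
    show ((σ₀ φ : GL (Fin 2) (PadicAlgCl 2)) : Matrix (Fin 2) (Fin 2) (PadicAlgCl 2)).charpoly = _
    rw [hPσ, hPab]
  rw [hkey] at hF
  refine ⟨_, a, b, ha, hb, hsatv, hunrv, hF, ?_⟩
  -- the congruence: `P ≡ θ(P_q)` (both reduce to `charpoly σ̄(φ)`) and `stub_predictedPolyCongr`
  have hqv : v.residueCard = q := Rat.residueCard_eq_natGenerator v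
  rw [hqv]
  set Hg : ℂ[X] := (heckePolynomial g q).map (algebraMap (coeffCharField g) ℂ) with hHg
  have hHgmonic : Hg.Monic := (monic_heckePolynomial g q).map _
  have hHgdeg : Hg.natDegree = 2 := by
    rw [hHg, map_heckePolynomial]
    compute_degree!
  have hθ' : (𝒪[PadicAlgCl 2]).subtype.comp θ =
      ((ι.symm : ℂ →+* PadicAlgCl 2).comp τ).comp
        (algebraMap (coeffCharIntegers f) (coeffCharField f)) :=
    RingHom.ext fun x => hθ x
  have hQH : (Pint.map θ).map (𝒪[PadicAlgCl 2]).subtype = Hg.map (ι.symm : ℂ →+* PadicAlgCl 2) := by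
    rw [Polynomial.map_map, hθ', ← Polynomial.map_map, ← Polynomial.map_map, hPint,
      ← hconj q hqp hqNM, hHg]
  have hcongr := stub_predictedPolyCongr ι hqodd (w : ℤ) (Pint.map θ) Hg hHgmonic hHgdeg hQH
  have hredθ' : red.comp θ = ιf := RingHom.ext hredθ
  have hdiff : ∀ i : ℕ, ‖(P.map (𝒪[PadicAlgCl 2]).subtype).coeff i -
      ((Pint.map θ).map (𝒪[PadicAlgCl 2]).subtype).coeff i‖ < 1 := by
    intro i
    have h1 : (P - Pint.map θ).map red = 0 := by
      rw [Polynomial.map_sub, Polynomial.map_map, hredθ', ← hPbar, sub_eq_zero]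
      exact hFrob 𝔓 h𝔓 φ hφF
    have h2 : red ((P - Pint.map θ).coeff i) = 0 := by
      have := congrArg (fun R : Polynomial k => R.coeff i) h1
      simpa only [Polynomial.coeff_map, Polynomial.coeff_zero] using this
    have h3 := (hred _).mp h2
    rw [Polynomial.coeff_map, Polynomial.coeff_map, ← map_sub, ← Polynomial.coeff_sub]
    exact h3
  intro i
  rw [← hPab]
  set x₁ := (P.map (𝒪[PadicAlgCl 2]).subtype).coeff i
  set x₂ := ((Pint.map θ).map (𝒪[PadicAlgCl 2]).subtype).coeff i
  set x₃ := (arithFrobPolyOfSatake ι q 2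
    (Hg.roots.map fun β => (((Real.sqrt q : ℝ) : ℂ)) ^ ((w : ℤ) - 1) * β⁻¹)).coeff i
  have htri := dist_triangle_max x₁ x₂ x₃
  simp only [dist_eq_norm] at htri
  exact lt_of_le_of_lt htri (max_lt (hdiff i) (hcongr i))



end Summit.Langlands.Langlands.Cruxes.ResidualBianchiDoorLevel.Sketch


namespace Summit.Langlands.Langlands.Cruxes.ResidualBianchiDoorLevelBC.FibreSubstitution

set_option linter.dupNamespace false

open scoped MatrixGroups Polynomial Valued Classical
open Polynomial NumberField IsDedekindDomain Filter
open Literature.NumberTheory.Automorphic Literature.NumberTheory.GaloisRepresentations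
  Summit.Langlands.Langlands.Theses.ParityBlindBianchi
  Summit.Langlands.Langlands.Cruxes.ResidualBianchiDoorLevel

/-! ## Conventions

The three `(2, ℚ, K)`-FIBRES of the Arthur–Clozel facts are written INLINE as binder types (no new
`def … : Prop`, so a landed copy carries no untagged Prop definitions): fibre (a) = clause (a) of
`QuadraticBaseChangeGL2` at `F = ℚ, E = K` (cuspidal weak lift given a non-twist witness at an inert
place, A–C III.4.2 (a)); fibre (c) = clause (c) (Satake powers at ALL finite places, A–C III.5.1);
fibre (d) = clause (d) (archimedean parameters restrict, A–C III.5.1 + I §7).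
-/

/-! ## Regular algebraicity ascends along the archimedean fibre -/

/-- `n = 2`, `(ℚ, K)` copy of `ArthurClozel1989_strongLifting_archimedean.isRegularAlgebraic_baseChange`
reading the archimedean transfer off the `(ℚ, K)`-fibre of clause (d) instead of the all-`n` named fact:
`T ↦ T^K` keeps the exponents. [cite: ArthurClozelAMS120, Ch. 3 Thm. 5.1 and Ch. 1 §7]
[cite: Clozel1990, Déf. 3.12] -/
theorem isRegularAlgebraic_of_archFibre {K : Type} [Field K] [NumberField K]
    {hF : isCompact_glFiniteIntegralLevel 2 ℚ} {hE : isCompact_glFiniteIntegralLevel 2 K}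
    {π : CuspidalAutomorphicRepData 2 ℚ hF} {P : CuspidalAutomorphicRepData 2 K hE}
    (hD : IsWeakBaseChangeLiftAE π.1 P.1 →
      ∀ χ : (ℚ →+* ℂ) → Multiset ℂ, π.1.HasArchParameter χ →
        P.1.HasArchParameter fun τ => χ (τ.comp (algebraMap ℚ K)))
    (hBC : IsWeakBaseChangeLiftAE π.1 P.1) (hπ : π.1.IsRegularAlgebraic) :
    P.1.IsRegularAlgebraic := by
  obtain ⟨T, hT, hC, hR⟩ := hπ
  refine ⟨T.baseChange K, ⟨hT.1.baseChange, ?_⟩, hC.baseChange, hR.baseChange⟩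
  have := hD hBC (fun σ => (T σ).map ArchWeight.a) hT.2
  simpa [InfinityType.baseChange] using this

/-! ## First lemma of the line: the K-side transfer over the fibres -/

/-- **`stub_bcTransfer_fibre`** — the landed `Sketch.stub_bcTransfer` (p98028) with its three
all-`n` named-fact hypotheses replaced by the `(2, ℚ, K)`-fibres: for `σ₀, S, π` as in
`stub_qLevel`, a quadratic `K` and a non-twist witness at an inert place, `Π = BC_K(π)` is regular
algebraic cuspidal and congruent to `σ₀|_{Γ_K}` at EVERY place of `K` over no prime of `S`.
Proof = the landed proof with the three use-sites swapped. [cite: ArthurClozelAMS120, Ch. 3 Thm. 4.2 (a) and Thm. 5.1] -/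
theorem stub_bcTransfer_fibre (K : Type) [Field K] [NumberField K] (hK : Module.finrank ℚ K = 2)
    (hA : ∀ (hF : isCompact_glFiniteIntegralLevel 2 ℚ) (π : CuspidalAutomorphicRepData 2 ℚ hF),
      (∃ (v : HeightOneSpectrum (𝓞 ℚ)) (w : HeightOneSpectrum (𝓞 K)) (α : Multiset ℂ),
          w.asIdeal.under (𝓞 ℚ) = v.asIdeal ∧ w.asIdeal.inertiaDeg (𝓞 ℚ) = Module.finrank ℚ K ∧
          π.1.HasSatakeParamAt v α ∧
          ∀ ζ : ℂ, IsPrimitiveRoot ζ (Module.finrank ℚ K) → α.map (ζ * ·) ≠ α) →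
      ∀ (hE : isCompact_glFiniteIntegralLevel 2 K),
        ∃ P : CuspidalAutomorphicRepData 2 K hE, IsWeakBaseChangeLiftAE π.1 P.1)
    (hCfin : ∀ (hF : isCompact_glFiniteIntegralLevel 2 ℚ) (hE : isCompact_glFiniteIntegralLevel 2 K)
      (π : CuspidalAutomorphicRepData 2 ℚ hF) (P : CuspidalAutomorphicRepData 2 K hE),
      IsWeakBaseChangeLiftAE π.1 P.1 →
        ∀ (w : HeightOneSpectrum (𝓞 K)) (v : HeightOneSpectrum (𝓞 ℚ)) (α : Multiset ℂ),
          w.asIdeal.under (𝓞 ℚ) = v.asIdeal → π.1.HasSatakeParamAt v α →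
            P.1.HasSatakeParamAt w (α.map (· ^ w.asIdeal.inertiaDeg (𝓞 ℚ))))
    (hD : ∀ (hF : isCompact_glFiniteIntegralLevel 2 ℚ) (hE : isCompact_glFiniteIntegralLevel 2 K)
      (π : CuspidalAutomorphicRepData 2 ℚ hF) (P : CuspidalAutomorphicRepData 2 K hE),
      IsWeakBaseChangeLiftAE π.1 P.1 →
        ∀ χ : (ℚ →+* ℂ) → Multiset ℂ, π.1.HasArchParameter χ →
          P.1.HasArchParameter fun τ => χ (τ.comp (algebraMap ℚ K)))
    (ι : PadicAlgCl 2 ≃+* ℂ) (σ₀ : FramedGaloisRep ℚ (PadicAlgCl 2) 2)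
    (S : Finset ℕ) (hcptQ : isCompact_glFiniteIntegralLevel 2 ℚ)
    (πQ : CuspidalAutomorphicRepData 2 ℚ hcptQ) (hRA : πQ.1.IsRegularAlgebraic)
    (hgood : ∀ v : HeightOneSpectrum (𝓞 ℚ), (∀ ℓ ∈ S, ((ℓ : ℕ) : 𝓞 ℚ) ∉ v.asIdeal) →
      ∃ (α : Multiset ℂ) (a b : PadicAlgCl 2), ‖a‖ ≤ 1 ∧ ‖b‖ ≤ 1 ∧
        πQ.1.HasSatakeParamAt v α ∧ σ₀.IsUnramifiedAt v ∧
        σ₀.HasFrobCharpolyAt v ((X - C a) * (X - C b)) ∧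
        ∀ i : ℕ, ‖((X - C a) * (X - C b)).coeff i -
          (arithFrobPolyOfSatake ι v.residueCard 2 α).coeff i‖ < 1)
    (hne : ∃ (v : HeightOneSpectrum (𝓞 ℚ)) (w : HeightOneSpectrum (𝓞 K)) (α : Multiset ℂ),
      w.asIdeal.under (𝓞 ℚ) = v.asIdeal ∧ w.asIdeal.inertiaDeg (𝓞 ℚ) = Module.finrank ℚ K ∧
      πQ.1.HasSatakeParamAt v α ∧
      ∀ ζ : ℂ, IsPrimitiveRoot ζ (Module.finrank ℚ K) → α.map (ζ * ·) ≠ α) :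
    ∃ (hcpt : isCompact_glFiniteIntegralLevel 2 K) (π₀ : CuspidalAutomorphicRepData 2 K hcpt),
      π₀.1.IsRegularAlgebraic ∧
        ∀ w : HeightOneSpectrum (𝓞 K), (∀ ℓ ∈ S, ((ℓ : ℕ) : 𝓞 K) ∉ w.asIdeal) →
          ∃ (α : Multiset ℂ) (P : Polynomial (PadicAlgCl 2)), π₀.1.HasSatakeParamAt w α ∧
            (σ₀.restrictField K).IsUnramifiedAt w ∧ (σ₀.restrictField K).HasFrobCharpolyAt w P ∧
            ∀ i : ℕ, ‖P.coeff i - (arithFrobPolyOfSatake ι w.residueCard 2 α).coeff i‖ < 1 := by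
  -- (2) the cuspidal weak lift `Π = BC_K(π)` (fibre (a)), regular algebraic (fibre (d))
  have hcpt : isCompact_glFiniteIntegralLevel 2 K := isCompact_glFiniteIntegralLevel_holds 2 K
  obtain ⟨P, hlift⟩ := hA hcptQ πQ hne hcpt
  have hRAP : P.1.IsRegularAlgebraic := isRegularAlgebraic_of_archFibre (hD hcptQ hcpt πQ P) hlift hRA
  refine ⟨hcpt, P, hRAP, fun w hw' => ?_⟩
  -- (3) the place `v` of `ℚ` below `w` is good
  set v : HeightOneSpectrum (𝓞 ℚ) := w.under (𝓞 ℚ) with hvdef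
  have hw : w.asIdeal.under (𝓞 ℚ) = v.asIdeal := rfl
  have hv : ∀ ℓ ∈ S, ((ℓ : ℕ) : 𝓞 ℚ) ∉ v.asIdeal := by
    intro ℓ hℓ hmem
    apply hw' ℓ hℓ
    rw [← hw, Ideal.under_def, Ideal.mem_comap, map_natCast] at hmem
    exact hmem
  obtain ⟨α, a, b, ha, hb, hsat, hunr, hFrob, hcongr⟩ := hgood v hv
  -- (4) Satake at `w` (fibre (c)), (5) the Galois side at `w`
  have hsatw := hCfin hcptQ hcpt πQ P hlift w v α hw hsat
  have hunrw : (σ₀.restrictField K).IsUnramifiedAt w := σ₀.isUnramifiedAt_restrictField hw hunr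
  have hFrobw := σ₀.hasFrobCharpolyAt_restrictField_fin_two (E := K) hw hunr hFrob
  refine ⟨_, _, hsatw, hunrw, hFrobw, ?_⟩
  -- (6) the congruence at `w`, `q_w = q_v ^ f`, `f ∈ {1, 2}`
  rw [residueCard_eq_pow_inertiaDeg_of_under_eq hw]
  rcases inertiaDeg_eq_one_or_two_of_finrank_eq_two hK v w hw with hf | hf
  · rw [hf]
    simpa only [pow_one, Multiset.map_id'] using hcongr
  · rw [hf]
    exact Sketch.arithFrobPolyOfSatake_congr_sq ι hsat.card_eq ha hb hcongr

/-! ## The crux BY NAME, conditional on the cited fact `khare_wintenberger` only -/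

/-- **E1″ from Khare–Wintenberger alone** (crux `ResidualBianchiDoorLevelBC` BY NAME): `intro hQ`,
then p125055 verbatim with `stub_bcTransfer` ↦ `stub_bcTransfer_fibre` fed by clauses (a), (c), (d)
of `hQ` at `(ℚ, K)`; clause (b) (unramified strong lifting / descent of unramifiedness) is NOT used. Trust base: the cited fact `khare_wintenberger`
(used only at `p = 2`). [cite: KhareWintenberger2009, Thm. 1.2 and Thm. 9.1]
[cite: ArthurClozelAMS120, Ch. 3 Thm. 4.2 (a) and Thm. 5.1] -/
theorem ResidualBianchiDoorLevelBC_of_KW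
    (hKW : ∀ (p : ℕ) [Fact p.Prime] (k : Type) [Field k] [TopologicalSpace k] [DiscreteTopology k],
      khare_wintenberger p k) :
    Summit.Langlands.Langlands.Theses.ParityBlindBianchi.ResidualBianchiDoorLevelBC := by
  intro hQ ι ρ hirr hA5
  obtain ⟨S, h2S, hS, σ₀, hσ₀, hcptQ, πQ, hRA, hgood⟩ := Sketch.stub_qLevel hKW ι ρ hirr hA5
  refine ⟨S, h2S, fun h0 => Nat.not_prime_zero (hS 0 h0), ?_⟩
  intro K _ _ _htc hdeg _hsplit
  -- the Galois side: the same `σ₀`, restricted to `Γ_K`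
  obtain ⟨σ₀', hσ₀', hfin, hproj, hmodel, hfinK, hirrK, hA5K⟩ :=
    Summit.Langlands.Langlands.Theorems.ResidualBianchiDoorMod2.exists_padicModel_restrictField
      ι ρ hA5 K hdeg
  obtain rfl : σ₀' = σ₀ := Sketch.framedGaloisRep_eq_of_toMonoidHom_eq (hσ₀'.trans hσ₀.symm)
  -- the automorphic side over `K`: the three fibres of the hypothesis at `(ℚ, K)` = clauses
  -- (a) `hQ.1`, (c) `hQ.2.2.1`, (d) `hQ.2.2.2` instantiated at `F := ℚ`, `E := K` (quadratic ⇒ Galois)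
  haveI : Algebra.IsQuadraticExtension ℚ K := ⟨hdeg⟩
  haveI : IsGalois ℚ K := inferInstance
  obtain ⟨hcpt, π₀, hRA₀, hgood₀⟩ := stub_bcTransfer_fibre K hdeg (hQ.1 ℚ K hdeg)
    (hQ.2.2.1 ℚ K hdeg) (hQ.2.2.2 ℚ K hdeg) ι σ₀' S hcptQ πQ hRA hgood
    (Sketch.stub_cuspWitness ι σ₀' hfin hproj S hS hcptQ πQ hgood K hdeg)
  exact ⟨σ₀'.restrictField K, hmodel, hfinK, hirrK, hA5K, hcpt, π₀, hRA₀, hgood₀⟩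

/-- **E1″ from Serre's conjecture MOD 2 alone** (crux `ResidualBianchiDoorLevelBC` BY NAME; the
promotion-ready form): same proof as `ResidualBianchiDoorLevelBC_of_KW` with `stub_qLevel` ↦
`stub_qLevel_two`, so the only hypothesis is the `p = 2` fibre `∀ k, khare_wintenberger 2 k`
(= Khare–Wintenberger (I) Thm 1.2 at `p = 2` with `k(ρ̄) = 2`, and Thm 9.1 under Kisin's 2-adic
Hypothesis (H) for `k(ρ̄) = 4`). [cite: KhareWintenberger2009, Thm. 1.2 and Thm. 9.1]
[cite: Kisin2009TwoAdic, Thm. 0.1, Cor. 0.2] [cite: ArthurClozelAMS120, Ch. 3 Thm. 4.2 (a) and Thm. 5.1] -/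
theorem ResidualBianchiDoorLevelBC_of_serreModTwo
    (hKW2 : ∀ (k : Type) [Field k] [TopologicalSpace k] [DiscreteTopology k],
      khare_wintenberger 2 k) :
    Summit.Langlands.Langlands.Theses.ParityBlindBianchi.ResidualBianchiDoorLevelBC := by
  intro hQ ι ρ hirr hA5
  obtain ⟨S, h2S, hS, σ₀, hσ₀, hcptQ, πQ, hRA, hgood⟩ := Sketch.stub_qLevel_two hKW2 ι ρ hirr hA5
  refine ⟨S, h2S, fun h0 => Nat.not_prime_zero (hS 0 h0), ?_⟩
  intro K _ _ _htc hdeg _hsplit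
  obtain ⟨σ₀', hσ₀', hfin, hproj, hmodel, hfinK, hirrK, hA5K⟩ :=
    Summit.Langlands.Langlands.Theorems.ResidualBianchiDoorMod2.exists_padicModel_restrictField
      ι ρ hA5 K hdeg
  obtain rfl : σ₀' = σ₀ := Sketch.framedGaloisRep_eq_of_toMonoidHom_eq (hσ₀'.trans hσ₀.symm)
  haveI : Algebra.IsQuadraticExtension ℚ K := ⟨hdeg⟩
  haveI : IsGalois ℚ K := inferInstance
  obtain ⟨hcpt, π₀, hRA₀, hgood₀⟩ := stub_bcTransfer_fibre K hdeg (hQ.1 ℚ K hdeg)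
    (hQ.2.2.1 ℚ K hdeg) (hQ.2.2.2 ℚ K hdeg) ι σ₀' S hcptQ πQ hRA hgood
    (Sketch.stub_cuspWitness ι σ₀' hfin hproj S hS hcptQ πQ hgood K hdeg)
  exact ⟨σ₀'.restrictField K, hmodel, hfinK, hirrK, hA5K, hcpt, π₀, hRA₀, hgood₀⟩

end Summit.Langlands.Langlands.Cruxes.ResidualBianchiDoorLevelBC.FibreSubstitution

end
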